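import Summits.Ventures.HSemireg.ObstructionLocusNCUnion
import Summits.Ventures.HSemireg.ObstructionLocusPolarised

/-!
# Venture HSemireg — (S5) OBSTRUCTION LOCUS away from secant type, XII: the BRIDGE — Bloch's contraction map on actual
# forms factors through the `κ`-model of file VI with signs `±1`

HONEST FRAMING.  Companion of files VI (`kappa`), VII (its rank) and XI (`thetaOp`, `bS`) (cell `pub-hsemireg`, track
«S4-PUSH» (ii), seat s4-prove-2).  Files VI/VII compute the rank of the contraction map `ξ ↦ ξ ⌟ [Z]` in a MODEL
(`kappa S ε`: target monomials indexed by `tg S q`, arbitrary non-zero coefficients).  This file proves, in Mathlib's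
exterior algebra `Λ(W ⊕ W̄)` with Mathlib's signs, that the ACTUAL map `v ↦ Σ_q v_q · θ_q(b_S)`
(`θ_q = dz̄_{q.1} ∧ ∂_{q.2}⌟`, `b_S = ∏_{s∈S} dz_s ∧ dz̄_s`) FACTORS as `monoFormMap ∘ kappa S sgn` — the `κ`-model with
the concrete signs `sgn q = ±1` followed by the linear map sending the monomial index `(A, B)` to the form
`dz̄_{b₁} ∧ dz̄_{b₂} ∧ b_A` (`{b₁ < b₂} = B ∖ A`).  Consequently `rank (ξ ↦ ξ ⌟ (b_S + b_{S'})) ≤` the closed form of file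
VII (`2p(N−p) − (p−1)(N−p−1) − 1`, `= n² + 2n − 2` at the Weil rung); EQUALITY needs the linear independence of the
monomial forms (left to a sequel).  DICTIONARY (not Lean): `[B_S] ∼ c_S · b_S` with `c_S ≠ 0`, `⊕H^{p,q} = Λ(W ⊕ W̄)`.
Nothing here says that HC / HC_CM / HC_AV holds; no Literature fact is declared or used.

* `sgn q = if q.1 < q.2 then 1 else −1` (never `0`); `monoForm (A, B)`; `monoFormMap`; `blochKappa c : v ↦ Σ_q v_q θ_q(c)`.
* `sdiff_tg` — `(S + i) ∖ (S − k) = {i, k}` for active `(i, k)`; `monoForm_tg` —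
  `monoForm (tg S (i,k)) = dz̄_{min} dz̄_{max} b_{S∖k}`.
* **`thetaOp_bS_eq_sgn_smul_monoForm`** — `θ_q(b_S) = sgn q • monoForm (tg S q)` if `q ∈ act S`, else `0`.
* **`blochKappa_bS`** — `blochKappa (b_S) = monoFormMap ∘ kappa S sgn`; **`blochKappa_bS_add`** for `b_S + b_{S'}`.
* **`finrank_range_blochKappa_pair_le`** — the actual rank is `≤` file VII's closed form (every near pair, Mathlib's signs).
-/

open scoped BigOperators
open CliffordAlgebra Finset

namespace Summit.Ventures.HSemireg.ObstructionLocus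

variable {K : Type*} [Field K] {n : ℕ}

/-! ## Signs and monomial forms -/

/-- The sign of the source `q = (i, k)`: `dz̄_i ∧ dz̄_k = sgn q · dz̄_{min} ∧ dz̄_{max}`. -/
def sgn (q : Fin n × Fin n) : K := if q.1 < q.2 then 1 else -1

/-- `sgn q ≠ 0` (it is `±1`). -/
theorem sgn_ne_zero (q : Fin n × Fin n) : (sgn q : K) ≠ 0 := by
  unfold sgn
  split_ifs
  · exact one_ne_zero
  · exact neg_ne_zero.2 one_ne_zero

/-- The form attached to the monomial index `(A, B)`: `dz̄_{b₁} ∧ dz̄_{b₂} ∧ b_A` summed over the ordered pairs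
`b₁ < b₂` of `B ∖ A` (exactly one pair when `|B ∖ A| = 2`, the only case that matters). -/
noncomputable def monoForm (m : Mono n) : Forms K n :=
  (∑ a ∈ m.2 \ m.1, ∑ b ∈ m.2 \ m.1, if a < b then dzb a * dzb b else 0) * bS m.1

/-- The linear map `e_{(A,B)} ↦ monoForm (A, B)` on monomial coefficient vectors. -/
noncomputable def monoFormMap : (Mono n → K) →ₗ[K] Forms K n :=
  ∑ m, (LinearMap.proj m).smulRight (monoForm m)

/-- `monoFormMap` on a basis vector. -/
theorem monoFormMap_single (m : Mono n) (a : K) :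
    monoFormMap (Pi.single m a) = a • (monoForm m : Forms K n) := by
  simp only [monoFormMap, LinearMap.sum_apply, LinearMap.smulRight_apply, LinearMap.proj_apply]
  rw [Finset.sum_eq_single m]
  · rw [Pi.single_eq_same]
  · intro m' _ hm'; rw [Pi.single_eq_of_ne hm', zero_smul]
  · intro h; exact absurd (Finset.mem_univ m) h

/-- **The actual contraction map** on `H¹(T_X)`-coefficient vectors against a form `c`:
`v ↦ Σ_q v_q · θ_q(c)`, `θ_q = dz̄_{q.1} ∧ (∂_{q.2} ⌟ ·)`. -/
noncomputable def blochKappa (c : Forms K n) : (Fin n × Fin n → K) →ₗ[K] Forms K n :=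
  ∑ q, (LinearMap.proj q).smulRight (thetaOp q.1 q.2 c)

/-- `blochKappa` on a basis vector. -/
theorem blochKappa_single (c : Forms K n) (q : Fin n × Fin n) (a : K) :
    blochKappa c (Pi.single q a) = a • thetaOp q.1 q.2 c := by
  simp only [blochKappa, LinearMap.sum_apply, LinearMap.smulRight_apply, LinearMap.proj_apply]
  rw [Finset.sum_eq_single q]
  · rw [Pi.single_eq_same]
  · intro q' _ hq'; rw [Pi.single_eq_of_ne hq', zero_smul]
  · intro h; exact absurd (Finset.mem_univ q) h

/-- `blochKappa` is additive in the form. -/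
theorem blochKappa_add (c c' : Forms K n) : blochKappa (c + c') = blochKappa c + blochKappa c' := by
  apply LinearMap.pi_ext
  intro q a
  rw [LinearMap.add_apply, blochKappa_single, blochKappa_single, blochKappa_single, map_add, smul_add]

/-! ## `θ_q(b_S)` in terms of `monoForm (tg S q)` -/

/-- For an active source `(i, k)` (`i ∉ S ∋ k`): `(S + i) ∖ (S − k) = {i, k}`. -/
theorem sdiff_tg {S : Finset (Fin n)} {i k : Fin n} (hi : i ∉ S) (hk : k ∈ S) :
    insert i S \ S.erase k = ({i, k} : Finset (Fin n)) := by
  ext x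
  simp only [Finset.mem_sdiff, Finset.mem_insert, Finset.mem_erase, Finset.mem_singleton]
  by_cases hxi : x = i
  · subst hxi
    simp [hi]
  · by_cases hxk : x = k
    · subst hxk
      simp [hk]
    · simp only [hxi, hxk, false_or, or_false, ne_eq, not_false_eq_true, true_and, iff_false, not_and,
        not_not]
      exact fun h => h

/-- `monoForm (tg S (i,k)) = dz̄_i dz̄_k b_{S∖k}` if `i < k`, `= dz̄_k dz̄_i b_{S∖k}` if `k < i` (active sources). -/
theorem monoForm_tg {S : Finset (Fin n)} {i k : Fin n} (hi : i ∉ S) (hk : k ∈ S) :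
    (monoForm (tg S (i, k)) : Forms K n)
      = (if i < k then dzb i * dzb k else dzb k * dzb i) * bS (S.erase k) := by
  have hik : i ≠ k := by rintro rfl; exact hi hk
  rw [monoForm, tg]
  dsimp only
  rw [sdiff_tg hi hk, Finset.sum_pair hik, Finset.sum_pair hik, Finset.sum_pair hik, if_neg (lt_irrefl i),
    if_neg (lt_irrefl k), zero_add, add_zero]
  rcases lt_or_gt_of_ne hik with h | h
  · rw [if_pos h, if_neg (not_lt.2 h.le), add_zero, if_pos h]
  · rw [if_neg (not_lt.2 h.le), if_pos h, zero_add, if_neg (not_lt.2 h.le)]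

/-- **`θ_q(b_S) = sgn q • monoForm (tg S q)` for active `q`, and `0` otherwise** — the `κ`-model rule of file VI, with
the concrete signs, as an identity of forms. -/
theorem thetaOp_bS_eq_sgn_smul_monoForm (S : Finset (Fin n)) (q : Fin n × Fin n) :
    thetaOp q.1 q.2 (bS S : Forms K n) = if q ∈ act S then (sgn q : K) • (monoForm (tg S q) : Forms K n) else 0 := by
  obtain ⟨i, k⟩ := q
  by_cases hq : (i, k) ∈ act S
  · obtain ⟨hi, hk⟩ := mem_act.1 hq
    have hik : i ≠ k := by rintro rfl; exact hi hk
    rw [if_pos hq, thetaOp_bS, if_pos hk, monoForm_tg hi hk, sgn]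
    dsimp only
    rcases lt_or_gt_of_ne hik with h | h
    · rw [if_pos h, if_pos h, one_smul]
    · rw [if_neg (not_lt.2 h.le), if_neg (not_lt.2 h.le), neg_one_smul,
        show (dzb i * dzb k : Forms K n) = -(dzb k * dzb i) from
          eq_neg_of_add_eq_zero_left (ExteriorAlgebra.ι_add_mul_swap _ _), neg_mul]
  · rw [if_neg hq]
    rw [mem_act, not_and_or, not_not] at hq
    rcases hq with hi | hk
    · exact thetaOp_bS_eq_zero_of_mem hi
    · rw [thetaOp_bS, if_neg hk]

/-! ## The factorisation and the rank bound -/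

/-- **BRIDGE: the actual contraction map against `b_S` is the `κ`-model of file VI (signs `sgn`) followed by
`monoFormMap`.** -/
theorem blochKappa_bS (S : Finset (Fin n)) :
    blochKappa (bS S : Forms K n) = monoFormMap ∘ₗ kappa S (sgn (K := K)) := by
  apply LinearMap.pi_ext
  intro q a
  rw [blochKappa_single, LinearMap.comp_apply, kappa_single, thetaOp_bS_eq_sgn_smul_monoForm]
  by_cases hq : q ∈ act S
  · rw [if_pos hq, if_pos hq, monoFormMap_single, smul_smul, mul_comm]
  · rw [if_neg hq, if_neg hq, smul_zero, map_zero]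

/-- The same for `b_S + b_{S'}` (any union: the class is the sum). -/
theorem blochKappa_bS_add (S S' : Finset (Fin n)) :
    blochKappa (bS S + bS S' : Forms K n) = monoFormMap ∘ₗ (kappa S (sgn (K := K)) + kappa S' (sgn (K := K))) := by
  rw [blochKappa_add, blochKappa_bS, blochKappa_bS, LinearMap.comp_add]

/-- **The actual rank is bounded by the model rank**: for a near pair, `rank (ξ ↦ ξ ⌟ (b_S + b_{S'})) ≤
2p(N−p) − (p−1)(N−p−1) − 1` (file VII's closed form; every `n`, Mathlib's signs).  Equality holds as soon as
`monoFormMap` is injective on the range of the model (the monomial forms are linearly independent) — a sequel. -/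
theorem finrank_range_blochKappa_pair_le {S S' : Finset (Fin n)} (hSS' : S ≠ S') {k k' : Fin n} (hk : k ∈ S)
    (hk' : k' ∈ S') (he : S.erase k = S'.erase k') :
    Module.finrank K (LinearMap.range (blochKappa (bS S + bS S' : Forms K n)))
      ≤ 2 * ((n - S.card) * S.card) - (n - S.card - 1) * (S.card - 1) - 1 := by
  rw [blochKappa_bS_add, LinearMap.range_comp,
    ← finrank_range_kappa_pair_of_near hSS' hk hk' he (fun q _ => sgn_ne_zero (K := K) q)
      (fun q _ => sgn_ne_zero (K := K) q)]
  exact Submodule.finrank_map_le _ _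

end Summit.Ventures.HSemireg.ObstructionLocus
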